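import Summits.KontsevichZagierPeriods.KontsevichZagierPeriods.Theorems.LogKernelConjecture.Negative.Sandwich
import Literature.NumberTheory.Transcendental.KZCalculusProofs
import Literature.NumberTheory.Transcendental.KZKernelConjectureForms
import Literature.NumberTheory.Transcendental.KZProductIdeal
import Literature.NumberTheory.Transcendental.KZFibredRelations
import Literature.NumberTheory.Transcendental.KZLogCalculusProofs

/-!
# Crux-triage r1 k=2 evidence for `LogKernelConjecture` (stmt-KontsevichZagierPeriods-2837)

§A  Card `rational-pushforward-normal-form`: its Transfer `NormalFormKernel` ("∀ R ≥ relations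
    log-closed, every vanishing ℤ-combination of normal-form generators (all base dimensions) lies
    in R") is the crux VERBATIM, because the generating set `normalFormGens d` contains, as its third
    component, EVERY `d`-dimensional representation `[s]`: over all `d` the generated subgroup is `⊤`
    (`closure_iUnion_normalFormGens_eq_top`), hence `normalFormKernel_iff : NormalFormKernel ↔ crux`
    with both directions one line.  Even the per-dimension reading (`NormalFormKernelDim`: the
    combination is supported in ONE `normalFormGens d`) is the crux, by slab lifting of any
    `[r] − [r']` to a common dimension (`exists_lift`, `normalFormKernelDim_iff`).  So the card's
    "WHY EASIER (a): generators of three rigid shapes instead of arbitrary semialgebraic reps" is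
    false as typed; the non-costume content of the card is `PureLogNormalForm` + `ArctanPrimitiveNL`.
§B  Card `spectator-localisation`: its "open structural stub" `CertificateFibration` (verbatim from
    `SketchIdeator2.lean`) is implied by the dimension-one structural half `SpectatorCancellation₁`
    with the witness `c' := 0` (`certificateFibration_of_spectatorCancellationDimOne`), and with the
    card's first lemma it is EQUIVALENT to it (`certificateFibration_iff`): the proposed split
    `SpectatorCancellation₁ = CertificateFibration + FibredSpectatorCancellation` lowers nothing —
    the residual IS the structural half; the first lemma `FibredSpectatorCancellation` is the only
    added content (it is NOT attacked here: it is implied by the kernel conjecture, since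
    `fibredRelations ≤ relations ≤ ker eval` and `eval` is multiplicative).
§C  Card `families-baker-semantic-log-rule`: its first lemma `VanishingLogTerm` (verbatim) is a
    consequence of the period conjecture (`vanishingLogTerm_of_kzKernelConjecture`, through the
    tree's PROVED `KZlog.kzKernelConjecture_iff_kernelConjecture`), so no value-level / small-model
    kill exists; and it is NOT closed by the calculus' own congruence move (`KZlog.congrRel` only
    modifies term data OFF the domain, KZLogCalculus.lean:368), i.e. it is a genuine sector.
-/

noncomputable section

set_option linter.dupNamespace false

open Literature.NumberTheory.Transcendental
open Summit.KontsevichZagierPeriods.KontsevichZagierPeriods.Theses.LiouvilleUnfolding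
  (LogKernelConjecture LogPrimitiveNL)
open Summit.KontsevichZagierPeriods.LiouvilleUnfolding.LogKernelConjectureNegative

namespace Summit.KontsevichZagierPeriods.KontsevichZagierPeriods.Cruxes.LogKernelConjecture.Triage2

/-! ## §A  `NormalFormKernel` is the crux in costume -/

/-- Pure-log shape `[{x ∈ τ, 1 ≤ u ≤ v x}, h x / u]` (card rational-pushforward-normal-form,
`IsPureLogRep`, re-typed from the card text). -/
def IsPureLogRep (d : ℕ) (s : KZ.IntegralRep (d + 1)) : Prop :=
  ∃ (τ : Set (Fin d → ℝ)) (h v : (Fin d → ℝ) → ℝ),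
    s.domain = {z | (Fin.init z : Fin d → ℝ) ∈ τ ∧ 1 ≤ z (Fin.last d) ∧
      z (Fin.last d) ≤ v (Fin.init z)} ∧
    Set.EqOn s.integrand (fun z => h (Fin.init z) / z (Fin.last d)) s.domain

/-- Pure-circular shape `[{x ∈ τ, 0 ≤ u ≤ v x}, h x / (1 + u²)]`. -/
def IsPureArctanRep (d : ℕ) (s : KZ.IntegralRep (d + 1)) : Prop :=
  ∃ (τ : Set (Fin d → ℝ)) (h v : (Fin d → ℝ) → ℝ),
    s.domain = {z | (Fin.init z : Fin d → ℝ) ∈ τ ∧ 0 ≤ z (Fin.last d) ∧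
      z (Fin.last d) ≤ v (Fin.init z)} ∧
    Set.EqOn s.integrand (fun z => h (Fin.init z) / (1 + z (Fin.last d) ^ 2)) s.domain

/-- The card's generating set over a base of dimension `d`: pure-log reps ∪ pure-arctan reps ∪ ALL
`d`-dimensional reps. -/
def normalFormGens (d : ℕ) : Set KZ.FormalRep :=
  {c | ∃ s : KZ.IntegralRep (d + 1), IsPureLogRep d s ∧ c = KZ.of s} ∪
  {c | ∃ s : KZ.IntegralRep (d + 1), IsPureArctanRep d s ∧ c = KZ.of s} ∪
  {c | ∃ s : KZ.IntegralRep d, c = KZ.of s}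

/-- The card's Transfer, union-over-dimensions reading ("all base dimensions"). -/
def NormalFormKernel : Prop :=
  ∀ R : AddSubgroup KZ.FormalRep, KZ.relations ≤ R → ClosedUnderLogNL R →
    ∀ c ∈ AddSubgroup.closure (⋃ d, normalFormGens d), KZ.eval c = 0 → c ∈ R

/-- The card's Transfer, per-dimension reading. -/
def NormalFormKernelDim : Prop :=
  ∀ R : AddSubgroup KZ.FormalRep, KZ.relations ≤ R → ClosedUnderLogNL R →
    ∀ (d : ℕ), ∀ c ∈ AddSubgroup.closure (normalFormGens d), KZ.eval c = 0 → c ∈ R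

/-- Every generator is a "normal-form generator" of its own dimension. -/
theorem of_mem_normalFormGens {d : ℕ} (s : KZ.IntegralRep d) : KZ.of s ∈ normalFormGens d :=
  Or.inr ⟨s, rfl⟩

/-- Every formal combination lies in the subgroup generated by the normal-form generators of all
dimensions. -/
theorem mem_closure_iUnion_normalFormGens (c : KZ.FormalRep) :
    c ∈ AddSubgroup.closure (⋃ d, normalFormGens d) := by
  induction c using FreeAbelianGroup.induction_on with
  | zero => exact AddSubgroup.zero_mem _
  | of p =>
    obtain ⟨n, s⟩ := p
    exact AddSubgroup.subset_closure (Set.mem_iUnion.2 ⟨n, of_mem_normalFormGens s⟩)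
  | neg p hp => exact AddSubgroup.neg_mem _ hp
  | add x y hx hy => exact AddSubgroup.add_mem _ hx hy

/-- Hence the normal-form generators of all dimensions generate EVERYTHING. -/
theorem closure_iUnion_normalFormGens_eq_top :
    AddSubgroup.closure (⋃ d, normalFormGens d) = (⊤ : AddSubgroup KZ.FormalRep) :=
  eq_top_iff.2 fun c _ => mem_closure_iUnion_normalFormGens c

/-- **COSTUME**: the Transfer is the crux, both directions trivial. -/
theorem normalFormKernel_iff : NormalFormKernel ↔ LogKernelConjecture := by
  rw [logKernelConjecture_iff]
  constructor
  · intro h R hrel hR c hc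
    refine h R hrel hR c ?_ hc
    rw [closure_iUnion_normalFormGens_eq_top]
    exact AddSubgroup.mem_top c
  · intro h R hrel hR c _ hc
    exact h R hrel hR c hc

/-- Slab lifting: every representation is move-equivalent to one of any higher dimension
(iterated `KZ.IntegralRep.of_slab_sub_of_mem_newtonLeibnizRel`). -/
theorem exists_lift (N : ℕ) : ∀ {n : ℕ}, n ≤ N → ∀ r : KZ.IntegralRep n,
    ∃ s : KZ.IntegralRep N, KZ.of s - KZ.of r ∈ KZ.relations := by
  induction N with
  | zero =>
    intro n hn r
    obtain rfl : n = 0 := Nat.le_zero.1 hn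
    exact ⟨r, by simp [KZ.relations.zero_mem]⟩
  | succ N ih =>
    intro n hn r
    rcases Nat.lt_or_ge n (N + 1) with hlt | hge
    · obtain ⟨s, hs⟩ := ih (Nat.lt_succ_iff.1 hlt) r
      refine ⟨s.slab 0, ?_⟩
      have h1 : KZ.of (s.slab 0) - KZ.of s ∈ KZ.relations :=
        KZ.newtonLeibnizRel_subset_relations (s.of_slab_sub_of_mem_newtonLeibnizRel 0)
      have := KZ.relations.add_mem h1 hs
      rwa [sub_add_sub_cancel] at this
    · obtain rfl : n = N + 1 := le_antisymm hn hge
      exact ⟨r, by simp [KZ.relations.zero_mem]⟩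

/-- **COSTUME (per-dimension reading too)**: by `KZ.exists_integralRep_sub_holds` and slab
lifting, every kernel element is `≡ [s] − [s']` with `s, s'` of one common dimension `D`, which is
a vanishing combination of `normalFormGens D` (third component). -/
theorem normalFormKernelDim_iff : NormalFormKernelDim ↔ LogKernelConjecture := by
  rw [logKernelConjecture_iff]
  constructor
  · intro h R hrel hR c hc
    obtain ⟨n, m, r, r', hrr⟩ := KZ.exists_integralRep_sub_holds c
    obtain ⟨s, hs⟩ := exists_lift (n + m) (Nat.le_add_right n m) r
    obtain ⟨s', hs'⟩ := exists_lift (n + m) (Nat.le_add_left m n) r'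
    have hmem : KZ.of s - KZ.of s' ∈ AddSubgroup.closure (normalFormGens (n + m)) :=
      AddSubgroup.sub_mem _ (AddSubgroup.subset_closure (of_mem_normalFormGens s))
        (AddSubgroup.subset_closure (of_mem_normalFormGens s'))
    have hcs : c - (KZ.of s - KZ.of s') ∈ KZ.relations := by
      have heq : c - (KZ.of s - KZ.of s') =
          (c - (KZ.of r - KZ.of r')) - (KZ.of s - KZ.of r) + (KZ.of s' - KZ.of r') := by abel
      rw [heq]
      exact KZ.relations.add_mem (KZ.relations.sub_mem hrr hs) hs'
    have hval : KZ.eval (KZ.of s - KZ.of s') = 0 := by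
      have h0 : KZ.eval (c - (KZ.of s - KZ.of s')) = 0 := KZ.relations_le_ker_eval_holds hcs
      rwa [map_sub, hc, zero_sub, neg_eq_zero] at h0
    have h1 : KZ.of s - KZ.of s' ∈ R := h R hrel hR (n + m) _ hmem hval
    have h2 : c - (KZ.of s - KZ.of s') ∈ R := hrel hcs
    have := R.add_mem h2 h1
    rwa [sub_add_cancel] at this
  · intro h R hrel hR d c _ hc
    exact h R hrel hR c hc

/-- Sanity: the crux's closure hypothesis name used above is the landed one
(`LogKernelConjectureNegative.ClosedUnderLogNL`, Negative/Sandwich.lean), and the crux unfolds to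
it definitionally. -/
example : LogKernelConjecture ↔
    ∀ R : AddSubgroup KZ.FormalRep, KZ.relations ≤ R → ClosedUnderLogNL R →
      ∀ c : KZ.FormalRep, KZ.eval c = 0 → c ∈ R := logKernelConjecture_iff

/-! ## §B  `CertificateFibration` is the dimension-one structural half in costume -/

/-- Structural half of card spectator-localisation for ONE-dimensional spectators. -/
def SpectatorCancellationDimOne : Prop :=
  ∀ (s : KZ.IntegralRep 1) (c : KZ.FormalRep), s.value ≠ 0 →
    KZ.of s * c ∈ KZ.relations → c ∈ KZ.relations

/-- VERBATIM from `SketchIdeator2.lean`. -/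
def FibredSpectatorCancellation : Prop :=
  ∀ (s : KZ.IntegralRep 1) (c : KZ.FormalRep), s.value ≠ 0 →
    KZ.of s * c ∈ KZ.fibredRelations → c ∈ KZ.relations

/-- VERBATIM from `SketchIdeator2.lean`. -/
def CertificateFibration : Prop :=
  ∀ (s : KZ.IntegralRep 1) (c : KZ.FormalRep), s.value ≠ 0 →
    KZ.of s * c ∈ KZ.relations →
      ∃ c' : KZ.FormalRep, c - c' ∈ KZ.relations ∧ KZ.of s * c' ∈ KZ.fibredRelations

/-- **The stub is implied by its own target, witness `c' := 0`.** -/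
theorem certificateFibration_of_spectatorCancellationDimOne (h : SpectatorCancellationDimOne) :
    CertificateFibration := by
  intro s c hs hsc
  refine ⟨0, ?_, ?_⟩
  · simpa using h s c hs hsc
  · rw [mul_zero]
    exact KZ.fibredRelations.zero_mem

/-- The card's own reduction (`spectatorCancellation_dimOne_of`, re-proved). -/
theorem spectatorCancellationDimOne_of (hF : CertificateFibration)
    (hC : FibredSpectatorCancellation) : SpectatorCancellationDimOne := by
  intro s c hs h
  obtain ⟨c', hcc', hc'⟩ := hF s c hs h
  have h1 : c' ∈ KZ.relations := hC s c' hs hc'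
  have := KZ.relations.add_mem hcc' h1
  rwa [sub_add_cancel] at this

/-- **Given the first lemma, `CertificateFibration ↔ SpectatorCancellation₁`**: the "single named
residual" is the whole dimension-one structural half. -/
theorem certificateFibration_iff (hC : FibredSpectatorCancellation) :
    CertificateFibration ↔ SpectatorCancellationDimOne :=
  ⟨fun hF => spectatorCancellationDimOne_of hF hC,
    certificateFibration_of_spectatorCancellationDimOne⟩

/-- And unconditionally `SpectatorCancellation₁ → CertificateFibration ∧ (first lemma is moot)`:
the split is a tautology on the side that matters. -/
theorem certificateFibration_and_of (h : SpectatorCancellationDimOne) :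
    CertificateFibration ∧ (FibredSpectatorCancellation → SpectatorCancellationDimOne) :=
  ⟨certificateFibration_of_spectatorCancellationDimOne h, fun _ => h⟩

/-! ## §C  `VanishingLogTerm` is summit-implied (unkillable by values) -/

/-- VERBATIM from card families-baker-semantic-log-rule (First lemma). -/
def VanishingLogTerm : Prop :=
  ∀ (n : ℕ) (T : KZlog.IntegralRep n), (∀ x ∈ T.domain, T.integrand x = 0) →
    KZlog.of T ∈ KZlog.relations

/-- The syntactic kernel conjecture gives it at once (value of a pointwise-zero term is `0`). -/
theorem vanishingLogTerm_of_kernelConjecture (h : KZlog.KernelConjecture) : VanishingLogTerm := by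
  intro n T hT
  apply h
  rw [KZlog.eval_of, KZlog.Term.value_eq]
  exact MeasureTheory.setIntegral_eq_zero_of_forall_eq_zero hT

/-- Hence the ordinary kernel conjecture (the summit) gives it (tree: conservativity of `KZlog`,
PROVED, `KZlog.kzKernelConjecture_iff_kernelConjecture`). -/
theorem vanishingLogTerm_of_kzKernelConjecture (h : KZKernelConjecture) : VanishingLogTerm :=
  vanishingLogTerm_of_kernelConjecture (KZlog.kzKernelConjecture_iff_kernelConjecture.1 h)

/-- … and therefore the crux together with its sibling 2836 gives it (Disproof §3 sandwich). -/
theorem vanishingLogTerm_of_cruxes (h₁ : LogPrimitiveNL) (h₂ : LogKernelConjecture) :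
    VanishingLogTerm :=
  vanishingLogTerm_of_kzKernelConjecture (kzKernelConjecture_of_logPrimitiveNL h₁ h₂)

end Summit.KontsevichZagierPeriods.KontsevichZagierPeriods.Cruxes.LogKernelConjecture.Triage2
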